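import Literature.MathematicalPhysics.QuantumFieldTheory.Balaban1983to89.B3Ineq212RegularRegion
import Literature.MathematicalPhysics.QuantumFieldTheory.Balaban1983to89.B3Ineq210RegularBox

/-!
# Bałaban, *(Higgs)₂,₃ quantum fields in a finite volume III* [B3] — (2.12) p. 426, the AVERAGED-VECTOR-LEG member
# `|G^η_{(j)}(Γ^{(j+1)}_{x_{j+1},x}, b)| ≤ O(1)(L^jη)^{−d+3}e^{−δ₁(L^jη)^{−1}dist(B^j(x),b)}` ON A CELL-PRODUCT BOX OF BIG BLOCKS `Ω ⊆ T_η`,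
# AT **EVERY** POINT `x ∈ Ω` AND EVERY BOND WITH BASE POINT IN `Ω` (no `R₀`-margin; [B1] p. 611 l.1–2) — PROVED for a concrete carrier of
# `B3Sect2StatementsPart2.ScaledKernels` (`Ineq212 δ₁ C` DISCHARGED, together with (2.10) on the same carrier), every charge

statement-level skeleton of published theorems with citation tags; proofs where landed; nothing here is a claim about the Yang–Mills mass gap

T. Bałaban, Commun. Math. Phys. **88** (1983) 411–445 [cite: Balaban1983Higgs3]; inputs from part I, Commun. Math. Phys. **85** (1982)
603–636 [cite: Balaban1982Higgs1], as landed in the tree.  PDF held: `paper:balaban1983-higgs-2-3-quantum-fields-finite-volume` p. 426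
[PDF 16]; `paper:balaban1982-cmp85-higgs23-i` p. 608 [PDF 6] ((2.1)–(2.2)), pp. 610–611 [PDF 8–9].

CITATION HEADER (lean-in-tree rule).  Cell `lit-balaban` (HOME `run/shared/lean/pub/lit-balaban/`), Phase-2 proof seat **p35** gen 21
(unit `lit-balaban-p35`); SKELETON row **B3.Eq2.12** (fold owner r15; decl of record `ScaledKernels.Ineq212`; LOCATED MEMBER, no head
claim); the BOX TWIN of p26 g33's REGION member `B3Ineq212RegularRegion` (big-block unions, BLOCK-INTERIOR points) and the companion of this
seat's `B3Ineq210RegularBox` (p346902) / `B3Ineq211RegularBox`.  USED BY NAME, never restated: p26's composite contour `contourBondsR` with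
`blockIter_of_mem_contourBondsR`, the averaged leg `gsumR`, the block distance `distBlockR` and THE ENGINE `absGavg_le_of_pointwise`
(«an additional factor L^jη»); this seat's `R₀`-free box member of (2.10) `B3Ineq210RegularBox.ineq210_regularBox_explicit_small` (value
clause at EVERY pair of points of the box, derivative clause at every bond of the box, ONE smallness parameter, every charge) and its
carrier vocabulary (`cellBox`, `pieceR`).

## What is printed (p. 426 [PDF 16], verbatim)

*«If a leg A′ of the line is in one of the vertices (1.14) and (1.15), then we have the expression A′^{(j),η}(Γ^{j+1}_{x_{j+1},x}) on the
basis of (1.3). For each such expression we have an additional factor L^jη on the right side, e.g. we have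
|G^η_{(j)}(Γ^{(j+1)}_{x_{j+1},x}, b)| ≤ O(1)(L^jη)^{−d+3}e^{−δ₁(L^jη)^{−1}dist(B^j(x),b)}. (2.12) … They all are obtained by rescaling from the
η-lattice to the L^{−j}-lattice and application of Propositions I.2.1 and I.2.3.»*  [Balaban1982Higgs1] p. 611 [PDF 9] l.1–2, verbatim:
*«For some simple sets Ω, e.g. for rectangular parallelepipeds, the inequalities hold without any restrictions on the points x, x′.»*

## What this file proves (`ineq210_and_212_regularBoxV`, `ineq212_regularBox`, `ineq212_regularBox_explicit`), and how

For `Ω = cellBox k K₀ S` (a product of unions of `L^kK₀`-cells, `K₀ ∣ M`, three cells a side), scalar lines at a `δ_A`-regular background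
`A` on `Ω` with `L^kδ_A|e| ≤ t(K₀)` and vector lines at zero background: `(regBoxKernelsV _ C S A m² a k K₀).Ineq210 δ₁ C ∧ … .Ineq212 δ₁ C` —
sites = ALL points of `Ω`, bonds = all fine bonds (the (2.12) field at a bond whose base point lies outside `Ω`, and the derivative field at
a bond leaving `Ω`, are `0`: nothing claimed there).  Route = p26's `ineq210_and_212_regularRegionV` line by line with the (2.10) input
replaced by the every-point box member: the base points of `Γ^{(j+1)}_{x_{j+1},x}` lie in `B^k(x) ⊆ Ω` for `j < k` (`blockIter_of_mem_contourBondsR`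
and `Ω` a union of `k`-blocks), so the pointwise hypothesis of `absGavg_le_of_pointwise` is the value clause of
`ineq210_regularBox_explicit_small` at `A = 0` (`δ_A = 0`); the constant is `dL·C_{(2.10)}·e^{δ₁L}`.

## Honest scope

Exactly p26's dictionary (vector pieces at `A = 0` with the selector `δ_{νμ}`, `|·|` = column sum, `distBlock = ε·dist(B^j(x), b)`) on this
seat's box carrier; NOT covered: regions that are not cell products; `m² = 0`; volumes with `K₀ ∤ M` or fewer than three cells a side;
constants depend on `K₀`, chosen after the charge data.  No `def … : Prop`, no new named fact (`regBoxKernelsV` is a concrete `def`);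
axioms standard.
-/

noncomputable section

open scoped BigOperators

namespace Literature.MathematicalPhysics.QuantumFieldTheory.Balaban1983to89.B3Ineq212RegularBox

open HiggsLattice (ChargeData ScalarField covDeriv)
open HiggsAveraging (blockIter)
open B1Eq230FluctCov (Ix cb)
open B3Sect2StatementsPart2 (ScaledKernels)
open B1TorusCubeCover (half)
open B1TorusRegionHSizes (IsBigBlockUnion)
open B3Ineq210RegularTorus (mesh_eq_pow_mul)
open B3Ineq210RegularRegion (pieceR pieceR_of_le blockUnion_of_isBigBlockUnion)
open B3Ineq212RegularRegion (contourBondsR blockIter_of_mem_contourBondsR gsumR gsumR_of_le distBlockR absGavg_le_of_pointwise)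
open B1Ineq225RegularBox (cellBox isBigBlockUnion_cellBox)
open B3Ineq210RegularBox (ineq210_regularBox_explicit_small)

variable {P : HiggsLattice.Params} {N : ℕ}

/-! ## §1 The carrier on the box with the (2.12) field, and the transfer lemmas -/

/-- **The concrete carrier of B3 (2.10)/(2.12) on a CELL-PRODUCT BOX `Ω = cellBox k K₀ S ⊆ T_η`** — scalar lines at a regular non-constant
background `B̃ = A`, vector lines at zero background: sites = ALL points of `Ω` (no margin), bonds = all positively oriented fine bonds;
`dist = ε|x − x′|`; `absG`/`absDG` exactly as this seat's `B3Ineq210RegularBox.regBoxKernels` (the region pieces `pieceR` of (2.6); the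
derivative field at a bond leaving `Ω` is `0`); the vector-line field `absGavg j x b = ε^{−d}Σ_{i′}‖G^η_{(j)}(Γ^{(j+1)}_{x_{j+1},x}, b)e_{i′}‖` (p26's
`gsumR`: the pieces AT ZERO BACKGROUND summed along the composite contour with the selector `δ_{νμ}`) when the base point `x_b ∈ Ω`, and `0`
(nothing claimed) otherwise; `distBlock j x b = dist(B^j(x), b)` (`distBlockR`); the (2.5)/(2.11) fields are not modelled (`0`).
[cite: Balaban1983Higgs3, (2.6) p.424, (2.10), (2.12) p.426] [cite: Balaban1982Higgs1, Prop. 2.1 p.610, p.611 l.1–2] -/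
def regBoxKernelsV {P : HiggsLattice.Params} {N : ℕ} (hL1 : 1 < P.L) (C : ChargeData N) (S : Fin P.d → Finset ℕ)
    (A : HiggsLattice.VecField P 0) (msq a : ℝ) (k K₀ : ℕ) : ScaledKernels where
  Site := {x : HiggsLattice.Site P 0 // x ∈ cellBox k K₀ S}
  Bond := HiggsLattice.PBond P 0
  Dir := Fin P.d
  LocFn := PUnit
  dist := fun x x' => P.mesh 0 * (HiggsLattice.Site.tdist x.1 x'.1 : ℝ)
  dist2 := fun _ _ _ => 0
  distBlock := fun j x b => distBlockR P j x.1 (b.src, b.dir)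
  distSupp := fun _ _ => 0
  distΩ₂ := 0
  L := P.L
  η := P.mesh 0
  d := P.d
  eRun := 0
  pRun := 0
  one_lt_L := by exact_mod_cast hL1
  η_pos := P.mesh_pos 0
  absG := fun j x x' => (P.mesh 0 ^ P.d)⁻¹ * ∑ i' : Ix N, ‖pieceR C (cellBox k K₀ S) A msq a k j (cb P N 0 (x'.1, i')) x.1‖
  absDG := fun j μ x x' => by
    classical
    exact if x.1.shift μ ∈ cellBox k K₀ S then
      (P.mesh 0 ^ P.d)⁻¹ * ∑ i' : Ix N, ‖covDeriv C A (pieceR C (cellBox k K₀ S) A msq a k j (cb P N 0 (x'.1, i'))) ⟨x.1, μ⟩‖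
    else 0
  holderDiff := fun _ _ _ _ _ => 0
  absGavg := fun j x b => by
    classical
    exact if b.src ∈ cellBox k K₀ S then
      (P.mesh 0 ^ P.d)⁻¹ * ∑ i' : Ix N, ‖gsumR C (cellBox k K₀ S) msq a k j x.1 (b.src, b.dir) i'‖
    else 0
  normDeltaG := fun _ _ _ => 0
  norm116 := fun _ _ _ _ _ => 0

section CarrierBV

variable {hL1 : 1 < P.L} {C : ChargeData N} {S : Fin P.d → Finset ℕ} {A : HiggsLattice.VecField P 0} {msq a : ℝ} {k K₀ : ℕ}

/-- the carrier's `L^jη` is the model's `L^jε`. [cite: Balaban1983Higgs3, (2.12) p.426] -/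
theorem scaleBV_eq (j : ℕ) : (regBoxKernelsV hL1 C S A msq a k K₀).scale j = P.mesh j := by
  show (P.L : ℝ) ^ j * P.mesh 0 = P.mesh j
  rw [mesh_eq_pow_mul P j]

/-- **Transfer for (2.10)**: the box kernel bounds in print's units (the shape of `ineq210_regularBox_explicit_small`'s conclusion: value at
every pair of points of the box, derivative at every bond of the box) give `Ineq210` for the carrier. [cite: Balaban1983Higgs3, (2.10) p.426] -/
theorem ineq210_of_boundsBV {δ₁ Cst : ℝ} (hCst : 0 ≤ Cst)
    (hvd : ∀ (j : ℕ) (x x' : HiggsLattice.Site P 0), x ∈ cellBox k K₀ S → x' ∈ cellBox k K₀ S →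
      (P.mesh 0 ^ P.d)⁻¹ * ∑ i' : Ix N, ‖pieceR C (cellBox k K₀ S) A msq a k j (cb P N 0 (x', i')) x‖
        ≤ Cst * P.mesh j ^ ((2 : ℝ) - (P.d : ℝ)) *
          Real.exp (-(δ₁ * (P.mesh j)⁻¹ * (P.mesh 0 * (HiggsLattice.Site.tdist x x' : ℝ)))) ∧
      ∀ μ : Fin P.d, x.shift μ ∈ cellBox k K₀ S →
        (P.mesh 0 ^ P.d)⁻¹ * ∑ i' : Ix N, ‖covDeriv C A (pieceR C (cellBox k K₀ S) A msq a k j (cb P N 0 (x', i'))) ⟨x, μ⟩‖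
          ≤ Cst * P.mesh j ^ ((1 : ℝ) - (P.d : ℝ)) *
            Real.exp (-(δ₁ * (P.mesh j)⁻¹ * (P.mesh 0 * (HiggsLattice.Site.tdist x x' : ℝ))))) :
    (regBoxKernelsV hL1 C S A msq a k K₀).Ineq210 δ₁ Cst := by
  classical
  intro j x x'
  have e1 : (regBoxKernelsV hL1 C S A msq a k K₀).absG j x x'
      = (P.mesh 0 ^ P.d)⁻¹ * ∑ i' : Ix N, ‖pieceR C (cellBox k K₀ S) A msq a k j (cb P N 0 (x'.1, i')) x.1‖ := rfl
  have e3 : (regBoxKernelsV hL1 C S A msq a k K₀).dist x x' = P.mesh 0 * (HiggsLattice.Site.tdist x.1 x'.1 : ℝ) := rfl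
  have e4 : (regBoxKernelsV hL1 C S A msq a k K₀).d = P.d := rfl
  rw [scaleBV_eq, e1, e3, e4]
  obtain ⟨hv, hd⟩ := hvd j x.1 x'.1 x.2 x'.2
  refine ⟨hv, fun μ => ?_⟩
  have e2 : (regBoxKernelsV hL1 C S A msq a k K₀).absDG j μ x x'
      = if x.1.shift μ ∈ cellBox k K₀ S then
          (P.mesh 0 ^ P.d)⁻¹ * ∑ i' : Ix N, ‖covDeriv C A (pieceR C (cellBox k K₀ S) A msq a k j (cb P N 0 (x'.1, i'))) ⟨x.1, μ⟩‖
        else 0 := rfl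
  rw [e2]
  split_ifs with hμ
  · exact hd μ hμ
  · have hmj : 0 < P.mesh j := P.mesh_pos j
    positivity

/-- **Transfer for (2.12)**: a bound on the averaged leg at every `x ∈ Ω` and every bond with base point `x_b ∈ Ω`, in the model's units,
gives `Ineq212` for the carrier (`0 ≤ C` covers the un-modelled bonds). [cite: Balaban1983Higgs3, (2.12) p.426] -/
theorem ineq212_of_boundBV {δ₁ Cst : ℝ} (hCst : 0 ≤ Cst)
    (h : ∀ (j : ℕ) (x xb : HiggsLattice.Site P 0) (μ : Fin P.d), x ∈ cellBox k K₀ S → xb ∈ cellBox k K₀ S →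
      (P.mesh 0 ^ P.d)⁻¹ * ∑ i' : Ix N, ‖gsumR C (cellBox k K₀ S) msq a k j x (xb, μ) i'‖
        ≤ Cst * P.mesh j ^ ((3 : ℝ) - (P.d : ℝ)) * Real.exp (-(δ₁ * (P.mesh j)⁻¹ * distBlockR P j x (xb, μ)))) :
    (regBoxKernelsV hL1 C S A msq a k K₀).Ineq212 δ₁ Cst := by
  classical
  intro j x b
  have e1 : (regBoxKernelsV hL1 C S A msq a k K₀).absGavg j x b
      = if b.src ∈ cellBox k K₀ S then
          (P.mesh 0 ^ P.d)⁻¹ * ∑ i' : Ix N, ‖gsumR C (cellBox k K₀ S) msq a k j x.1 (b.src, b.dir) i'‖ else 0 := rfl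
  have e2 : (regBoxKernelsV hL1 C S A msq a k K₀).distBlock j x b = distBlockR P j x.1 (b.src, b.dir) := rfl
  have e3 : (regBoxKernelsV hL1 C S A msq a k K₀).d = P.d := rfl
  rw [scaleBV_eq, e1, e2, e3]
  split_ifs with hb
  · exact h j x.1 b.src b.dir x.2 hb
  · have hmj : 0 < P.mesh j := P.mesh_pos j
    positivity

end CarrierBV

/-! ## §2 (2.10) ∧ (2.12) PROVED for the box carrier at every point; (2.12) un-subtyped -/

section MainBV

/-- weakening of the constant in a bound of the shape `C·s·e`. [folklore] -/
private theorem bound_mono {C C' s e v : ℝ} (h : v ≤ C * s * e) (hC : C ≤ C') (hs : 0 ≤ s) (he : 0 ≤ e) : v ≤ C' * s * e :=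
  h.trans (mul_le_mul_of_nonneg_right (mul_le_mul_of_nonneg_right hC hs) he)

/-- `Cst ≤ dL·Cst·e^{δ₁L}` for `d ≥ 1`, `L ≥ 1`, `δ₁ ≥ 0`, `Cst ≥ 0` (p26's constant bookkeeping, copied: it is private there). [folklore] -/
private theorem le_cst212 {d L : ℕ} (hd : 1 ≤ d) (hL : 1 ≤ L) {Cst δ₁ : ℝ} (hCst : 0 ≤ Cst) (hδ₁ : 0 ≤ δ₁) :
    Cst ≤ (d : ℝ) * (L : ℝ) * Cst * Real.exp (δ₁ * L) := by
  have hd' : (1 : ℝ) ≤ d := by exact_mod_cast hd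
  have hL' : (1 : ℝ) ≤ L := by exact_mod_cast hL
  have he : 1 ≤ Real.exp (δ₁ * L) := Real.one_le_exp (by positivity)
  have hdL : (1 : ℝ) ≤ (d : ℝ) * (L : ℝ) := by nlinarith
  calc Cst = 1 * Cst * 1 := by ring
    _ ≤ (d : ℝ) * (L : ℝ) * Cst * Real.exp (δ₁ * L) := by
        refine mul_le_mul (mul_le_mul_of_nonneg_right hdL hCst) he zero_le_one (by positivity)

/-- **B3 (2.10) AND (2.12) p. 426 [PDF 16] PROVED TOGETHER ON A CELL-PRODUCT BOX OF BIG BLOCKS, AT EVERY POINT OF THE BOX — scalar lines at a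
regular non-constant background `B̃ = A`, vector lines at zero background — uniformly in the volume, same constants, ONE smallness parameter,
every charge.**  For `d ≥ 1`, `L ≥ 2`, `a, m² > 0`, `N` and EVERY charge there is a threshold `K₀,min` and, for every `K₀ ≥ K₀,min`, constants
`t, δ₁, C > 0` with: for every volume `P` with these `d, L` and `K₀ ∣ M`, every scale `1 ≤ k ≤ K` with `L^kε ≤ 1` and `3L^kK₀ ≤ |T_ε|_μ`, every
cell-product box `Ω = cellBox k K₀ S` and every configuration `A` that is `δ_A`-regular ON `Ω` with `L^kδ_A|e| ≤ t`:
`(regBoxKernelsV _ C S A m² a k K₀).Ineq210 δ₁ C ∧ (regBoxKernelsV _ C S A m² a k K₀).Ineq212 δ₁ C` — in particular, for all `j`, ALL `x ∈ Ω` and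
all fine bonds `b` with `x_b ∈ Ω`, `ε^{−d}Σ_{i′}‖G^η_{(j)}(Γ^{(j+1)}_{x_{j+1},x}, b)e_{i′}‖ ≤ C(L^jη)^{3−d}e^{−δ₁(L^jη)^{−1}dist(B^j(x),b)}` with NO margin.
Route = p26's `ineq210_and_212_regularRegionV` with the (2.10) input `ineq210_regularBox_explicit_small` (once at `A`, once at `A = 0` where
the hypotheses hold with `δ_A = 0`) and the engine `absGavg_le_of_pointwise`; the base points of `Γ^{(j+1)}_{x_{j+1},x}` lie in `B^k(x) ⊆ Ω`
(`blockIter_of_mem_contourBondsR`, `Ω` a union of `k`-blocks).  Honest scope: module docstring.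
[cite: Balaban1983Higgs3, (2.6) p.424, (2.10), (2.12) p.426] [cite: Balaban1982Higgs1, Prop. 2.1 p.610, p.611 l.1–2, Prop. 2.3 p.611, (2.2) p.608] -/
theorem ineq210_and_212_regularBoxV (d L : ℕ) (hd : 1 ≤ d) (hL : 2 ≤ L) {a : ℝ} (ha : 0 < a) {msq : ℝ} (hmsq : 0 < msq)
    (N : ℕ) (C : ChargeData N) :
    ∃ K₀min : ℕ, ∀ K₀ : ℕ, K₀min ≤ K₀ → ∃ t δ₁ Cst : ℝ, 0 < t ∧ 0 < δ₁ ∧ 0 < Cst ∧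
      ∀ (P : HiggsLattice.Params) (hP1 : 1 < P.L), P.d = d → P.L = L → K₀ ∣ P.M →
      ∀ {k : ℕ}, 1 ≤ k → k ≤ P.K → (∀ μ, 3 * half P k K₀ ≤ P.sitesPerDir 0 μ) → P.mesh k ≤ 1 →
      ∀ (S : Fin P.d → Finset ℕ) (A : HiggsLattice.VecField P 0) {δA : ℝ}, 0 ≤ δA →
        (∀ z ∈ cellBox k K₀ S, ∀ μ ν : Fin P.d, |A ⟨z.shift ν, μ⟩ - A ⟨z, μ⟩| ≤ δA) →
        (P.L : ℝ) ^ k * δA * |C.e| ≤ t →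
        (regBoxKernelsV hP1 C S A msq a k K₀).Ineq210 δ₁ Cst ∧ (regBoxKernelsV hP1 C S A msq a k K₀).Ineq212 δ₁ Cst := by
  obtain ⟨K₀min, h⟩ := ineq210_regularBox_explicit_small d L hd hL ha hmsq N C
  refine ⟨K₀min, fun K₀ hK₀ => ?_⟩
  obtain ⟨t, δ₁, Cst, ht, hδ₁, hCst, h⟩ := h K₀ hK₀
  have hL1 : 1 ≤ L := by omega
  refine ⟨t, δ₁, (d : ℝ) * (L : ℝ) * Cst * Real.exp (δ₁ * L), ht, hδ₁, ?_, ?_⟩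
  · have hd0 : (0 : ℝ) < d := by exact_mod_cast hd
    have hL0 : (0 : ℝ) < L := by exact_mod_cast (by omega : 0 < L)
    positivity
  intro P hP1 hPd hPL hK₀M k hk1 hkK h3 hmesh S A δA hδA hreg ht'
  have hCC : Cst ≤ (d : ℝ) * (L : ℝ) * Cst * Real.exp (δ₁ * L) := le_cst212 hd hL1 hCst.le hδ₁.le
  have hCC0 : 0 ≤ (d : ℝ) * (L : ℝ) * Cst * Real.exp (δ₁ * L) := hCst.le.trans hCC
  -- (2.10) on the box at the background `A` (scalar lines) and at `A = 0` (vector lines), at EVERY point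
  have hA := h P hP1 hPd hPL hK₀M hk1 hkK h3 hmesh S A hδA hreg ht'
  have h0 := h P hP1 hPd hPL hK₀M hk1 hkK h3 hmesh S (0 : HiggsLattice.VecField P 0) (δA := 0) le_rfl
    (fun z _ μ ν => by simp) (by rw [mul_zero, zero_mul]; exact ht.le)
  subst hPd hPL
  have hΩ : IsBigBlockUnion k K₀ (cellBox k K₀ S) := isBigBlockUnion_cellBox S
  have hΩk : ∀ y y' : HiggsLattice.Site P 0, blockIter k y = blockIter k y' → (y ∈ cellBox k K₀ S ↔ y' ∈ cellBox k K₀ S) :=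
    blockUnion_of_isBigBlockUnion le_rfl hΩ
  refine ⟨ineq210_of_boundsBV hCC0 (fun j x x' hx hx' => ⟨?_, fun μ hμ => ?_⟩), ineq212_of_boundBV hCC0 (fun j x xb μ hx hxb => ?_)⟩
  · have hmj : 0 < P.mesh j := P.mesh_pos j
    have hsr : 0 ≤ P.mesh j ^ ((2 : ℝ) - (P.d : ℝ)) := (Real.rpow_pos_of_pos hmj _).le
    exact bound_mono (hA j x x' hx hx').1 hCC hsr (Real.exp_pos _).le
  · have hmj : 0 < P.mesh j := P.mesh_pos j
    have hsr : 0 ≤ P.mesh j ^ ((1 : ℝ) - (P.d : ℝ)) := (Real.rpow_pos_of_pos hmj _).le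
    exact bound_mono ((hA j x x' hx hx').2 μ hμ) hCC hsr (Real.exp_pos _).le
  · have hmj : 0 < P.mesh j := P.mesh_pos j
    rcases Nat.lt_or_ge j k with hjk | hkj
    · -- `j < k ≤ K`: every base point of `Γ^{(j+1)}_{x_{j+1},x}` lies in `B^k(x) ⊆ Ω`, and `x_b ∈ Ω`
      exact absGavg_le_of_pointwise hjk hkK hδ₁.le hCst.le fun b' hb' =>
        (h0 j b'.1 xb ((hΩk b'.1 x (blockIter_of_mem_contourBondsR (by omega) hkK hb')).2 hx) hxb).1
    · -- `j ≥ k`: no piece, the averaged leg vanishes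
      have hzero : ∀ i' : Ix N, gsumR C (cellBox k K₀ S) msq a k j x (xb, μ) i' = 0 :=
        fun i' => gsumR_of_le (hk1.trans hkj) hkj x (xb, μ) i'
      simp_rw [hzero, norm_zero, Finset.sum_const_zero, mul_zero]
      positivity

/-- **B3 (2.12) p. 426 [PDF 16] PROVED ON A CELL-PRODUCT BOX AT EVERY POINT, uniformly in the volume** — the decl of record
`ScaledKernels.Ineq212 δ₁ C` of row B3.Eq2.12 DISCHARGED for the concrete carrier `regBoxKernelsV _ C S A m² a k K₀`: for all `j`, ALL `x ∈ Ω`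
and all fine bonds `b` with base point in `Ω`, `ε^{−d}Σ_{i′}‖G^η_{(j)}(Γ^{(j+1)}_{x_{j+1},x}, b)e_{i′}‖ ≤ C(L^jη)^{3−d}e^{−δ₁(L^jη)^{−1}dist(B^j(x),b)}` —
*«For some simple sets Ω, e.g. for rectangular parallelepipeds, the inequalities hold without any restrictions on the points x, x′»* carried
into (2.12). [cite: Balaban1983Higgs3, (2.12) p.426] [cite: Balaban1982Higgs1, Prop. 2.1 p.610, p.611 l.1–2, (2.2) p.608] -/
theorem ineq212_regularBox (d L : ℕ) (hd : 1 ≤ d) (hL : 2 ≤ L) {a : ℝ} (ha : 0 < a) {msq : ℝ} (hmsq : 0 < msq)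
    (N : ℕ) (C : ChargeData N) :
    ∃ K₀min : ℕ, ∀ K₀ : ℕ, K₀min ≤ K₀ → ∃ t δ₁ Cst : ℝ, 0 < t ∧ 0 < δ₁ ∧ 0 < Cst ∧
      ∀ (P : HiggsLattice.Params) (hP1 : 1 < P.L), P.d = d → P.L = L → K₀ ∣ P.M →
      ∀ {k : ℕ}, 1 ≤ k → k ≤ P.K → (∀ μ, 3 * half P k K₀ ≤ P.sitesPerDir 0 μ) → P.mesh k ≤ 1 →
      ∀ (S : Fin P.d → Finset ℕ) (A : HiggsLattice.VecField P 0) {δA : ℝ}, 0 ≤ δA →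
        (∀ z ∈ cellBox k K₀ S, ∀ μ ν : Fin P.d, |A ⟨z.shift ν, μ⟩ - A ⟨z, μ⟩| ≤ δA) →
        (P.L : ℝ) ^ k * δA * |C.e| ≤ t →
        (regBoxKernelsV hP1 C S A msq a k K₀).Ineq212 δ₁ Cst := by
  obtain ⟨K₀min, h⟩ := ineq210_and_212_regularBoxV d L hd hL ha hmsq N C
  refine ⟨K₀min, fun K₀ hK₀ => ?_⟩
  obtain ⟨t, δ₁, Cst, ht, hδ₁, hCst, h⟩ := h K₀ hK₀
  refine ⟨t, δ₁, Cst, ht, hδ₁, hCst, ?_⟩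
  intro P hP1 hPd hPL hK₀M k hk1 hkK h3 hmesh S A δA hδA hreg ht'
  exact (h P hP1 hPd hPL hK₀M hk1 hkK h3 hmesh S A hδA hreg ht').2

/-- **The same, un-subtyped**: (2.12) on the box for every `j`, EVERY `x ∈ Ω` and every fine bond `⟨x_b, x_b + εe_μ⟩` with `x_b ∈ Ω`, in the
model's units — the form consumers on the full lattice use (r14's (1.16) programme / chapter-3 vertices, box step).
[cite: Balaban1983Higgs3, (2.12) p.426] [cite: Balaban1982Higgs1, Prop. 2.1 p.610, p.611 l.1–2] -/
theorem ineq212_regularBox_explicit (d L : ℕ) (hd : 1 ≤ d) (hL : 2 ≤ L) {a : ℝ} (ha : 0 < a) {msq : ℝ} (hmsq : 0 < msq)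
    (N : ℕ) (C : ChargeData N) :
    ∃ K₀min : ℕ, ∀ K₀ : ℕ, K₀min ≤ K₀ → ∃ t δ₁ Cst : ℝ, 0 < t ∧ 0 < δ₁ ∧ 0 < Cst ∧
      ∀ (P : HiggsLattice.Params), 1 < P.L → P.d = d → P.L = L → K₀ ∣ P.M →
      ∀ {k : ℕ}, 1 ≤ k → k ≤ P.K → (∀ μ, 3 * half P k K₀ ≤ P.sitesPerDir 0 μ) → P.mesh k ≤ 1 →
      ∀ (S : Fin P.d → Finset ℕ) (A : HiggsLattice.VecField P 0) {δA : ℝ}, 0 ≤ δA →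
        (∀ z ∈ cellBox k K₀ S, ∀ μ ν : Fin P.d, |A ⟨z.shift ν, μ⟩ - A ⟨z, μ⟩| ≤ δA) →
        (P.L : ℝ) ^ k * δA * |C.e| ≤ t →
        ∀ (j : ℕ) (x xb : HiggsLattice.Site P 0) (μ : Fin P.d), x ∈ cellBox k K₀ S → xb ∈ cellBox k K₀ S →
          (P.mesh 0 ^ P.d)⁻¹ * ∑ i' : Ix N, ‖gsumR C (cellBox k K₀ S) msq a k j x (xb, μ) i'‖
            ≤ Cst * P.mesh j ^ ((3 : ℝ) - (P.d : ℝ)) * Real.exp (-(δ₁ * (P.mesh j)⁻¹ * distBlockR P j x (xb, μ))) := by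
  classical
  obtain ⟨K₀min, h⟩ := ineq212_regularBox d L hd hL ha hmsq N C
  refine ⟨K₀min, fun K₀ hK₀ => ?_⟩
  obtain ⟨t, δ₁, Cst, ht, hδ₁, hCst, h⟩ := h K₀ hK₀
  refine ⟨t, δ₁, Cst, ht, hδ₁, hCst, ?_⟩
  intro P hP1 hPd hPL hK₀M k hk1 hkK h3 hmesh S A δA hδA hreg ht' j x xb μ hx hxb
  have h' := h P hP1 hPd hPL hK₀M hk1 hkK h3 hmesh S A hδA hreg ht' j ⟨x, hx⟩ ⟨xb, μ⟩
  have e1 : (regBoxKernelsV hP1 C S A msq a k K₀).absGavg j ⟨x, hx⟩ ⟨xb, μ⟩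
      = if xb ∈ cellBox k K₀ S then
          (P.mesh 0 ^ P.d)⁻¹ * ∑ i' : Ix N, ‖gsumR C (cellBox k K₀ S) msq a k j x (xb, μ) i'‖ else 0 := rfl
  have e2 : (regBoxKernelsV hP1 C S A msq a k K₀).distBlock j ⟨x, hx⟩ ⟨xb, μ⟩ = distBlockR P j x (xb, μ) := rfl
  have e3 : (regBoxKernelsV hP1 C S A msq a k K₀).d = P.d := rfl
  rw [scaleBV_eq, e1, if_pos hxb, e2, e3] at h'
  exact h'

end MainBV

end Literature.MathematicalPhysics.QuantumFieldTheory.Balaban1983to89.B3Ineq212RegularBox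

end
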